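import Literature.NumberTheory.EllipticCurves.ModularParamYRationality
import Literature.NumberTheory.EllipticCurves.CuspFormsGamma0IntegralBasisProofs
import Literature.NumberTheory.EllipticCurves.LatticeInclusionRigidityProofs
import HarnessLib

/-!
# Bounded denominators of the modular parametrisation at `∞` (no `q`-expansion principle)

Topic `NumberTheory/EllipticCurves`; a proofs-only file (theorems only, no definitions, no named
facts). Let `f ∈ S₂(Γ₀(N))` be nonzero with *integral* Fourier coefficients, `Λ(L) ⊇ Λ_f` with
`g₂(L), g₃(L) ∈ ℚ`, and `(F, G)` a presentation of `x = ℘_Λ(2πi∫f)` by cusp forms of weight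
`k ≥ 2` on `Γ₀(N)` (`ModularParamXFunction`); `x = xFn`, `y = yFn ∈ K_N ⊆ ℂ((q))`. The tree knows
that the Laurent `q`-series of `x` and `y` are fixed by `Aut(ℂ)` (`mapLaurent_xFn`,
`mapLaurent_yFn`), i.e. have rational coefficients. Here we bound their denominators:

* `exists_rat_presentation` — **`x` is presented by cusp forms with rational coordinates**: there
  are `F₁, G₁ ∈ S_k(Γ₀(N))`, `G₁ ≠ 0`, with `x·q-exp(G₁) = q-exp(F₁)` whose coordinates in an
  integral basis of `S_k(Γ₀(N))` (Shimura, Thm. 3.52; the tree's `exists_basis_int_cuspCoeff`)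
  are rational — hence `D₁·q-exp(G₁), D₂·q-exp(F₁) ∈ ℤ⟦q⟧` for some integers `D₁, D₂ ≥ 1`.
  Proof: Galois descent of the subspace `V = {G' : x·G' is a cusp form}` of `S_k(Γ₀(N))`, which
  is stable under the coefficientwise action of `Aut(ℂ)` (because `x` is); a nonzero element of
  `V` of minimal support in the integral basis, normalised to have a coordinate `1`, is fixed by
  `Aut(ℂ)` (`exists_ne_zero_rat_coords_of_conj_stable`).
* `IsXPresentation.exists_int_series_of_mul_yFn_eq` — **bounded denominators of `z = −X/Y`**: for
  every `z ∈ ℂ⟦q⟧` with `z·y = −2x` in `ℂ((q))` there are `z_ℚ ∈ ℚ⟦q⟧` mapping to `z` and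
  `P, Q ∈ ℤ⟦q⟧`, `Q ≠ 0`, with `z_ℚ·Q = P` (namely `Q = D₁D₂(b₁θa₁ − a₁θb₁)`,
  `P = −2D₁D₂a₁b₁e` for the expansions `a₁, b₁, e` of `F₁, G₁, f`). Consequently `z` has
  `p`-integral coefficients for every prime `p` not dividing the leading coefficient of `Q`
  (drawn in `ModularParametrizationCongruenceHondaProofs`). The existence of such `z` with
  `log_E(z) = Σ aₙqⁿ/n` is `IsXPresentation.exists_formalLog_subst_eq` (`ModularParamFormalLogProofs`).

Classically both statements follow from the `q`-expansion principle on the model of `X₀(N)` over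
`ℤ[1/N]` (Katz 1973, §1.6; Shimura 1971, §6.2 with Thm. 3.52); the point of this file is that the
cruder "cofinitely many primes" version needs only Thm. 3.52 and linear algebra.

## References

* G. Shimura, *Introduction to the arithmetic theory of automorphic functions* (1971), Thm. 3.52
  (integral basis of `S_k(Γ₀(N))`), §6.2 and Thm. 7.14. [ShimuraIATAF1971]
* T. Honda, J. Math. Soc. Japan 22 (1970), §6.2, p. 241 ("for `p ∉ S′` … `j(z)⁻¹` has
  `p`-integral coefficients"). [Honda1970]
-/

noncomputable section

open Complex Filter Topology Set Function PowerSeries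
open UpperHalfPlane hiding I
open scoped Real Topology Manifold MatrixGroups PeriodPair ModularForm WithZero
open ModularForm CongruenceSubgroup

open Literature.NumberTheory.EllipticCurves

namespace Literature.NumberTheory.EllipticCurves.ModularForms

variable {N : ℕ} [NeZero N] {k : ℤ}

/-! ### `q`-expansions of differences and scalar multiples in `S_k(Γ₀(N))`

(The `q`-expansion principle itself — two cusp forms on `Γ₀(N)` with the same Fourier coefficients
are equal — is `eq_of_forall_cuspCoeff_eq_gamma0` of `CuspFormLFunction`.) -/

omit [NeZero N] in
/-- `q`-expansion of a difference of cusp forms. [folklore] -/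
theorem qExpansion_cuspForm_sub (F G : CuspForm (Gamma0 N) k) :
    qExpansion 1 (⇑(F - G)) = qExpansion 1 (⇑F) - qExpansion 1 (⇑G) := by
  have hsub : (⇑(F - G) : ℍ → ℂ) = ⇑F - ⇑G := rfl
  rw [hsub, ModularForm.qExpansion_sub one_pos (one_mem_strictPeriods_coe_gamma0 N) F G]

omit [NeZero N] in
/-- `q`-expansion of a scalar multiple of a cusp form. [folklore] -/
theorem qExpansion_cuspForm_smul (c : ℂ) (G : CuspForm (Gamma0 N) k) :
    qExpansion 1 (⇑(c • G)) = c • qExpansion 1 (⇑G) := by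
  have hs : (⇑(c • G) : ℍ → ℂ) = c • ⇑G := rfl
  rw [hs]
  exact ModularForm.qExpansion_smul one_pos (one_mem_strictPeriods_coe_gamma0 N) c G

omit [NeZero N] in
/-- The `q`-expansion in terms of `cuspCoeff`. [folklore] -/
theorem qExpansion_eq_mk_cuspCoeff (G : CuspForm (Gamma0 N) k) :
    qExpansion 1 (⇑G) = PowerSeries.mk fun n ↦ cuspCoeff G n := by
  ext n; rw [coeff_mk]; rfl

/-! ### Conjugation of cusp forms along an integral basis -/

section Conj

variable {r : ℕ} (g : Module.Basis (Fin r) ℂ (CuspForm (Gamma0 N) k))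

omit [NeZero N] in
/-- Coordinates of `Σ cᵢ gᵢ`. [folklore] -/
theorem equivFun_symm_apply_coord (c : Fin r → ℂ) (i : Fin r) :
    g.equivFun (g.equivFun.symm c) i = c i := by
  rw [LinearEquiv.apply_symm_apply]

omit [NeZero N] in
/-- **Fourier coefficients of the conjugate form** `F^σ := Σ σ(cᵢ) gᵢ` along an integral basis
`(gᵢ)`: `aₘ(F^σ) = σ(aₘ(F))`. [cite: ShimuraIATAF1971, Thm. 3.52] -/
theorem cuspCoeff_equivFun_symm_conj_gamma0 (hg : ∀ i m, ∃ z : ℤ, cuspCoeff (g i) m = z)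
    (σ : ℂ →+* ℂ) (F : CuspForm (Gamma0 N) k) (m : ℕ) :
    cuspCoeff (g.equivFun.symm fun i ↦ σ (g.equivFun F i)) m = σ (cuspCoeff F m) := by
  conv_rhs => rw [← g.sum_equivFun F]
  rw [Module.Basis.equivFun_symm_apply, cuspCoeff_sum_smul, cuspCoeff_sum_smul, map_sum]
  refine Finset.sum_congr rfl fun i _ ↦ ?_
  obtain ⟨z, hz⟩ := hg i m
  rw [map_mul, hz, map_intCast]

omit [NeZero N] in
/-- The `q`-expansion of the conjugate form is the conjugate `q`-expansion. [folklore] -/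
theorem qExpansion_equivFun_symm_conj (hg : ∀ i m, ∃ z : ℤ, cuspCoeff (g i) m = z)
    (σ : ℂ →+* ℂ) (F : CuspForm (Gamma0 N) k) :
    qExpansion 1 (⇑(g.equivFun.symm fun i ↦ σ (g.equivFun F i))) = (qExpansion 1 (⇑F)).map σ := by
  ext m
  rw [coeff_map]
  exact cuspCoeff_equivFun_symm_conj_gamma0 g hg σ F m

omit [NeZero N] in
/-- The same for a field automorphism `σ` (coercion-free form). [folklore] -/
theorem qExpansion_equivFun_symm_conj_equiv (hg : ∀ i m, ∃ z : ℤ, cuspCoeff (g i) m = z)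
    (σ : ℂ ≃+* ℂ) (F : CuspForm (Gamma0 N) k) :
    qExpansion 1 (⇑(g.equivFun.symm fun i ↦ σ (g.equivFun F i))) =
      (qExpansion 1 (⇑F)).map (σ : ℂ →+* ℂ) :=
  qExpansion_equivFun_symm_conj g hg (σ : ℂ →+* ℂ) F

omit [NeZero N] in
/-- A form fixed by conjugation has `σ`-fixed coordinates. [folklore] -/
theorem equivFun_eq_of_conj_eq (σ : ℂ →+* ℂ) {F : CuspForm (Gamma0 N) k}
    (h : (g.equivFun.symm fun i ↦ σ (g.equivFun F i)) = F) (i : Fin r) :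
    σ (g.equivFun F i) = g.equivFun F i := by
  have := congrArg (fun H ↦ g.equivFun H i) h
  beta_reduce at this
  rwa [equivFun_symm_apply_coord] at this

omit [NeZero N] in
/-- **A cusp form with `Aut(ℂ)`-invariant `q`-expansion has rational coordinates in an integral
basis** (its conjugates have the same expansion, hence coincide with it). [folklore] -/
theorem exists_ratCast_eq_equivFun_of_map_eq (hg : ∀ i m, ∃ z : ℤ, cuspCoeff (g i) m = z)
    {F : CuspForm (Gamma0 N) k} (hF : ∀ σ : ℂ ≃+* ℂ, (qExpansion 1 (⇑F)).map (σ : ℂ →+* ℂ) = qExpansion 1 (⇑F))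
    (i : Fin r) : ∃ q : ℚ, (q : ℂ) = g.equivFun F i := by
  refine exists_ratCast_eq_of_forall_ringEquiv fun σ ↦ ?_
  refine equivFun_eq_of_conj_eq g (σ : ℂ →+* ℂ) (eq_of_forall_cuspCoeff_eq_gamma0 fun n ↦ ?_) i
  rw [cuspCoeff_equivFun_symm_conj_gamma0 g hg]
  have := congrArg (coeff n) (hF σ)
  rw [coeff_map] at this
  exact this

omit [NeZero N] in
/-- **Bounded denominators for a form with rational coordinates**: if all coordinates of `F` in
an integral basis are rational, some positive integer `D` clears the denominators of all Fourier
coefficients: `D·aₘ(F) ∈ ℤ` for all `m`. [cite: ShimuraIATAF1971, Thm. 3.52] -/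
theorem exists_int_mul_cuspCoeff_of_rat_coords (hg : ∀ i m, ∃ z : ℤ, cuspCoeff (g i) m = z)
    {F : CuspForm (Gamma0 N) k} (hF : ∀ i, ∃ q : ℚ, (q : ℂ) = g.equivFun F i) :
    ∃ D : ℕ, 0 < D ∧ ∀ m, ∃ z : ℤ, (D : ℂ) * cuspCoeff F m = z := by
  classical
  choose q hq using hF
  -- `D = ∏ den(qᵢ)`
  refine ⟨∏ i, (q i).den, Finset.prod_pos fun i _ ↦ (q i).den_pos, fun m ↦ ?_⟩
  choose z hz using fun i ↦ hg i m
  have hF' : F = ∑ i, g.equivFun F i • g i := (g.sum_equivFun F).symm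
  -- each `D qᵢ` is an integer
  have hDq : ∀ i, ∃ w : ℤ, ((∏ j, (q j).den : ℕ) : ℚ) * q i = w := by
    intro i
    obtain ⟨c, hc⟩ : (q i).den ∣ ∏ j, (q j).den := Finset.dvd_prod_of_mem _ (Finset.mem_univ i)
    refine ⟨c * (q i).num, ?_⟩
    rw [hc, Nat.cast_mul, mul_comm ((q i).den : ℚ), mul_assoc, Rat.den_mul_eq_num]
    push_cast; ring
  choose w hw using hDq
  refine ⟨∑ i, w i * z i, ?_⟩
  conv_lhs => rw [hF', cuspCoeff_sum_smul]
  rw [Finset.mul_sum]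
  push_cast
  refine Finset.sum_congr rfl fun i _ ↦ ?_
  rw [← hq i, hz i, ← mul_assoc]
  congr 1
  have := congrArg (fun t : ℚ ↦ (t : ℂ)) (hw i)
  push_cast at this
  exact this

end Conj

/-! ### Galois descent: a conjugation-stable subspace has a nonzero rational vector -/

section Descent

variable {r : ℕ} (g : Module.Basis (Fin r) ℂ (CuspForm (Gamma0 N) k))

omit [NeZero N] in
/-- **Minimal-support descent.** Let `S ⊆ S_k(Γ₀(N))` be closed under differences and scalars and
stable under the conjugations `F ↦ F^σ = Σ σ(cᵢ)gᵢ` (`σ ∈ Aut(ℂ)`) along a basis `(gᵢ)`. If `S`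
has a nonzero element, it has a nonzero element all of whose coordinates are rational: an element
of minimal support, scaled to have a coordinate `1`, differs from each conjugate by an element of
`S` of smaller support, hence equals its conjugates. [folklore] -/
theorem exists_ne_zero_rat_coords_of_conj_stable (S : Set (CuspForm (Gamma0 N) k))
    (hsub : ∀ F ∈ S, ∀ F' ∈ S, F - F' ∈ S) (hsmul : ∀ (c : ℂ), ∀ F ∈ S, c • F ∈ S)
    (hconj : ∀ (σ : ℂ ≃+* ℂ), ∀ F ∈ S, (g.equivFun.symm fun i ↦ σ (g.equivFun F i)) ∈ S)
    (hne : ∃ F ∈ S, F ≠ 0) :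
    ∃ F ∈ S, F ≠ 0 ∧ ∀ i, ∃ q : ℚ, (q : ℂ) = g.equivFun F i := by
  classical
  -- support size of the coordinate vector
  let supp : CuspForm (Gamma0 N) k → Finset (Fin r) := fun F ↦
    Finset.univ.filter fun i ↦ g.equivFun F i ≠ 0
  have hsupp : ∀ F i, i ∈ supp F ↔ g.equivFun F i ≠ 0 := fun F i ↦ by simp [supp]
  have hP : ∃ n, ∃ F ∈ S, F ≠ 0 ∧ (supp F).card = n := by
    obtain ⟨F, hFS, hF0⟩ := hne
    exact ⟨_, F, hFS, hF0, rfl⟩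
  obtain ⟨F₀, hF₀S, hF₀0, hcard⟩ := Nat.find_spec hP
  have hmin : ∀ F ∈ S, F ≠ 0 → (supp F₀).card ≤ (supp F).card := by
    intro F hFS hF0
    rw [hcard]
    exact Nat.find_min' hP ⟨F, hFS, hF0, rfl⟩
  -- a nonzero coordinate `i₀`
  have hne_supp : (supp F₀).Nonempty := by
    by_contra h0
    rw [Finset.not_nonempty_iff_eq_empty] at h0
    apply hF₀0
    have hzero : g.equivFun F₀ = 0 := by
      funext i
      by_contra hi
      have : i ∈ supp F₀ := (hsupp F₀ i).mpr hi
      rw [h0] at this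
      exact absurd this (Finset.notMem_empty i)
    exact g.equivFun.injective (by rw [hzero, map_zero])
  obtain ⟨i₀, hi₀⟩ := hne_supp
  have hc₀ : g.equivFun F₀ i₀ ≠ 0 := (hsupp F₀ i₀).mp hi₀
  -- normalise: `F₁ = c₀⁻¹ F₀`
  set F₁ := (g.equivFun F₀ i₀)⁻¹ • F₀ with hF₁
  have hF₁S : F₁ ∈ S := hsmul _ _ hF₀S
  have hcoord : ∀ i, g.equivFun F₁ i = (g.equivFun F₀ i₀)⁻¹ * g.equivFun F₀ i := by
    intro i; rw [hF₁, map_smul]; rfl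
  have hF₁i₀ : g.equivFun F₁ i₀ = 1 := by rw [hcoord, inv_mul_cancel₀ hc₀]
  have hF₁0 : F₁ ≠ 0 := by
    intro h0
    have := hF₁i₀
    rw [h0, map_zero] at this
    exact zero_ne_one this
  have hsuppF₁ : supp F₁ = supp F₀ := by
    ext i
    rw [hsupp, hsupp, hcoord]
    exact (mul_ne_zero_iff.trans (and_iff_right (inv_ne_zero hc₀)))
  refine ⟨F₁, hF₁S, hF₁0, fun i ↦ exists_ratCast_eq_of_forall_ringEquiv fun σ ↦ ?_⟩
  -- `W = F₁ − F₁^σ ∈ S` has support in `supp F₁ \ {i₀}`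
  set W := F₁ - g.equivFun.symm (fun i ↦ σ (g.equivFun F₁ i)) with hW
  have hWS : W ∈ S := hsub _ hF₁S _ (hconj σ _ hF₁S)
  have hWcoord : ∀ j, g.equivFun W j = g.equivFun F₁ j - σ (g.equivFun F₁ j) := by
    intro j
    rw [hW, map_sub]
    change g.equivFun F₁ j - g.equivFun (g.equivFun.symm fun i ↦ σ (g.equivFun F₁ i)) j = _
    rw [equivFun_symm_apply_coord]
  by_contra hσ
  have hW0 : W ≠ 0 := by
    intro h0
    have := hWcoord i
    rw [h0, map_zero] at this
    exact hσ (sub_eq_zero.mp this.symm).symm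
  have hsub' : supp W ⊆ (supp F₁).erase i₀ := by
    intro j hj
    rw [hsupp] at hj
    rw [Finset.mem_erase, hsupp]
    constructor
    · rintro rfl
      rw [hWcoord, hF₁i₀, map_one, sub_self] at hj
      exact hj rfl
    · intro hj0
      rw [hWcoord, hj0, map_zero, sub_self] at hj
      exact hj rfl
  have hlt : (supp W).card < (supp F₀).card := by
    calc (supp W).card ≤ ((supp F₁).erase i₀).card := Finset.card_le_card hsub'
      _ < (supp F₁).card := Finset.card_erase_lt_of_mem (hsuppF₁ ▸ hi₀)
      _ = (supp F₀).card := by rw [hsuppF₁]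
  exact absurd (hmin W hWS hW0) (not_le.mpr hlt)

end Descent

/-! ### Application to `x = ℘_Λ(2πi∫f)`: a rational presentation -/

namespace IsXPresentation

variable {f : CuspForm (Gamma0 N) 2} {L : PeriodPair} {F G : CuspForm (Gamma0 N) k}

omit [NeZero N] in
/-- The defining relation of `xFn`, with explicit coercions. [folklore] -/
theorem coe_xFn_mul (h : IsXPresentation f L F G) :
    ((h.xFn : modularFunctionField N) : LaurentSeries ℂ) * ((qExpansion 1 (⇑G) : ℂ⟦X⟧) : LaurentSeries ℂ) =
      ((qExpansion 1 (⇑F) : ℂ⟦X⟧) : LaurentSeries ℂ) := by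
  rw [xFn_def]
  exact mkFn_mul (F : ModularForm (Gamma0 N) k) (G : ModularForm (Gamma0 N) k) h.modularForm_ne_zero

/-- **`x` is presented by cusp forms with rational coordinates, hence with bounded denominators.**
For `f ≠ 0` with rational coefficients, `g₂(L), g₃(L) ∈ ℚ` and a presentation of weight `k ≥ 2`,
there are `F₁, G₁ ∈ S_k(Γ₀(N))`, `G₁ ≠ 0`, with `x·q-exp(G₁) = q-exp(F₁)` in `ℂ((q))` and positive
integers `D₁, D₂` with `D₁aₘ(G₁), D₂aₘ(F₁) ∈ ℤ` for all `m` (Galois descent of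
`{G' : x·G' ∈ S_k}` plus Shimura's integral basis). [cite: ShimuraIATAF1971, Thm. 3.52 and Thm. 7.14] -/
theorem exists_rat_presentation (h : IsXPresentation f L F G) (hf : f ≠ 0) (hk : 2 ≤ k)
    (hrat : ∀ n, ∃ q : ℚ, (q : ℂ) = cuspCoeff f n) (hg₂ : ∃ q : ℚ, (q : ℂ) = L.g₂)
    (hg₃ : ∃ q : ℚ, (q : ℂ) = L.g₃) :
    ∃ (F₁ G₁ : CuspForm (Gamma0 N) k) (D₁ D₂ : ℕ), G₁ ≠ 0 ∧ 0 < D₁ ∧ 0 < D₂ ∧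
      ((h.xFn : modularFunctionField N) : LaurentSeries ℂ) * ((qExpansion 1 (⇑G₁) : ℂ⟦X⟧) : LaurentSeries ℂ) =
        ((qExpansion 1 (⇑F₁) : ℂ⟦X⟧) : LaurentSeries ℂ) ∧
      (∀ m, ∃ z : ℤ, (D₁ : ℂ) * cuspCoeff G₁ m = z) ∧ (∀ m, ∃ z : ℤ, (D₂ : ℂ) * cuspCoeff F₁ m = z) := by
  classical
  obtain ⟨r, g, hg⟩ := exists_basis_int_cuspCoeff N k hk
  obtain ⟨q₂, hq₂⟩ := hg₂
  obtain ⟨q₃, hq₃⟩ := hg₃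
  set x : LaurentSeries ℂ := ((h.xFn : modularFunctionField N) : LaurentSeries ℂ) with hx
  have hxσ : ∀ σ : ℂ ≃+* ℂ, mapLaurent (σ : ℂ →+* ℂ) x = x := fun σ ↦
    h.mapLaurent_xFn hf hrat σ (by rw [← hq₂, map_ratCast]) (by rw [← hq₃, map_ratCast])
  -- the conjugation-stable subspace
  set S : Set (CuspForm (Gamma0 N) k) := {G' | ∃ F' : CuspForm (Gamma0 N) k,
    x * ((qExpansion 1 (⇑G') : ℂ⟦X⟧) : LaurentSeries ℂ) = ((qExpansion 1 (⇑F') : ℂ⟦X⟧) : LaurentSeries ℂ)}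
    with hS
  have hsub : ∀ G' ∈ S, ∀ G'' ∈ S, G' - G'' ∈ S := by
    rintro G' ⟨F', hF'⟩ G'' ⟨F'', hF''⟩
    refine ⟨F' - F'', ?_⟩
    rw [qExpansion_cuspForm_sub, qExpansion_cuspForm_sub, PowerSeries.coe_sub, PowerSeries.coe_sub,
      mul_sub, hF', hF'']
  have hsmul : ∀ (c : ℂ), ∀ G' ∈ S, c • G' ∈ S := by
    rintro c G' ⟨F', hF'⟩
    refine ⟨c • F', ?_⟩
    rw [qExpansion_cuspForm_smul, qExpansion_cuspForm_smul, smul_eq_C_mul, smul_eq_C_mul,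
      PowerSeries.coe_mul, PowerSeries.coe_mul, ← hF']
    ring
  have hconj : ∀ (σ : ℂ ≃+* ℂ), ∀ G' ∈ S, (g.equivFun.symm fun i ↦ σ (g.equivFun G' i)) ∈ S := by
    rintro σ G' ⟨F', hF'⟩
    refine ⟨g.equivFun.symm fun i ↦ σ (g.equivFun F' i), ?_⟩
    rw [qExpansion_equivFun_symm_conj_equiv g hg, qExpansion_equivFun_symm_conj_equiv g hg,
      ← mapLaurent_coe_powerSeries, ← mapLaurent_coe_powerSeries, ← hF', map_mul, hxσ]
  have hne : ∃ G' ∈ S, G' ≠ 0 := ⟨G, ⟨F, h.coe_xFn_mul⟩, h.1⟩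
  obtain ⟨G₁, ⟨F₁, hF₁⟩, hG₁0, hG₁rat⟩ :=
    exists_ne_zero_rat_coords_of_conj_stable g S hsub hsmul hconj hne
  obtain ⟨D₁, hD₁, hD₁int⟩ := exists_int_mul_cuspCoeff_of_rat_coords g hg hG₁rat
  -- `G₁` is fixed by conjugation, hence so is `q-exp(F₁) = x · q-exp(G₁)`
  have hG₁fix : ∀ σ : ℂ ≃+* ℂ, (g.equivFun.symm fun i ↦ (σ : ℂ →+* ℂ) (g.equivFun G₁ i)) = G₁ := by
    intro σ
    have : (fun i ↦ (σ : ℂ →+* ℂ) (g.equivFun G₁ i)) = g.equivFun G₁ := by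
      funext i
      obtain ⟨q, hq⟩ := hG₁rat i
      rw [← hq, RingHom.coe_coe, map_ratCast]
    rw [this, LinearEquiv.symm_apply_apply]
  have hF₁fix : ∀ σ : ℂ ≃+* ℂ, (qExpansion 1 (⇑F₁)).map (σ : ℂ →+* ℂ) = qExpansion 1 (⇑F₁) := by
    intro σ
    apply HahnSeries.ofPowerSeries_injective (Γ := ℤ) (R := ℂ)
    change ((((qExpansion 1 (⇑F₁)).map (σ : ℂ →+* ℂ) : ℂ⟦X⟧) : LaurentSeries ℂ)) =
      ((qExpansion 1 (⇑F₁) : ℂ⟦X⟧) : LaurentSeries ℂ)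
    rw [← mapLaurent_coe_powerSeries, ← hF₁, map_mul, hxσ, mapLaurent_coe_powerSeries,
      ← qExpansion_equivFun_symm_conj g hg, hG₁fix]
  obtain ⟨D₂, hD₂, hD₂int⟩ :=
    exists_int_mul_cuspCoeff_of_rat_coords g hg (exists_ratCast_eq_equivFun_of_map_eq g hg hF₁fix)
  exact ⟨F₁, G₁, D₁, D₂, hG₁0, hD₁, hD₂, hF₁, hD₁int, hD₂int⟩

/-! ### Bounded denominators of `z = −X/Y` -/

omit [NeZero N] in
/-- A cusp form with `D·aₘ ∈ ℤ` for all `m`: `D·q-exp` comes from `ℤ⟦q⟧`. [folklore] -/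
theorem exists_int_series_of_int_mul_cuspCoeff {D : ℕ} {F₁ : CuspForm (Gamma0 N) k}
    (hD : ∀ m, ∃ z : ℤ, (D : ℂ) * cuspCoeff F₁ m = z) :
    ∃ A : ℤ⟦X⟧, A.map (Int.castRingHom ℂ) = C (D : ℂ) * qExpansion 1 (⇑F₁) := by
  choose z hz using hD
  refine ⟨PowerSeries.mk z, ?_⟩
  ext n
  rw [coeff_map, coeff_mk, coeff_C_mul, eq_intCast, ← hz n]
  rfl

omit [NeZero N] in
/-- `θ` of an integral series is integral. [folklore] -/
theorem map_mk_mul_coeff_eq_thetaPS (A : ℤ⟦X⟧) :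
    (PowerSeries.mk fun n ↦ (n : ℤ) * coeff n A).map (Int.castRingHom ℂ) = thetaPS (A.map (Int.castRingHom ℂ)) := by
  ext n
  rw [coeff_map, coeff_mk, coeff_thetaPS, coeff_map, map_mul, map_natCast]

/-- **Bounded denominators of the local parameter `z = −X/Y` along the modular parametrisation.**
Let `f ∈ S₂(Γ₀(N))` be nonzero with integral Fourier coefficients, `g₂(L), g₃(L) ∈ ℚ`, `(F, G)` a
presentation of weight `k ≥ 2` of `x = ℘_Λ(2πi∫f)`, and let `z ∈ ℂ⟦q⟧` satisfy `z·y = −2x` in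
`ℂ((q))` (`y = yFn`; such `z` exists, `exists_formalLog_subst_eq`). Then `z` has rational
coefficients, `z = z_ℚ`, and there are `P, Q ∈ ℤ⟦q⟧`, `Q ≠ 0`, with `z_ℚ·Q = P`; in particular
`z` is `p`-integral for every prime `p` not dividing the leading coefficient of `Q` (the content
of Honda 1970, §6.2, "for `p ∉ S′` the local parameter has `p`-integral coefficients", obtained
here without a model of `X₀(N)` over `ℤ_(p)`). [cite: Honda1970, §6.2 (p. 241)]
[cite: ShimuraIATAF1971, Thm. 3.52] -/
theorem exists_int_series_of_mul_yFn_eq (h : IsXPresentation f L F G) (hf : f ≠ 0) (hk : 2 ≤ k)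
    (hint : ∀ n, ∃ m : ℤ, (m : ℂ) = cuspCoeff f n) (hg₂ : ∃ q : ℚ, (q : ℂ) = L.g₂)
    (hg₃ : ∃ q : ℚ, (q : ℂ) = L.g₃) {z : ℂ⟦X⟧}
    (hz : (z : LaurentSeries ℂ) * ((h.yFn hf : modularFunctionField N) : LaurentSeries ℂ) =
      -2 * ((h.xFn : modularFunctionField N) : LaurentSeries ℂ)) :
    ∃ (zq : ℚ⟦X⟧) (P Q : ℤ⟦X⟧), zq.map (algebraMap ℚ ℂ) = z ∧ Q ≠ 0 ∧
      zq * Q.map (Int.castRingHom ℚ) = P.map (Int.castRingHom ℚ) := by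
  classical
  have hrat : ∀ n, ∃ q : ℚ, (q : ℂ) = cuspCoeff f n := fun n ↦ by
    obtain ⟨m, hm⟩ := hint n; exact ⟨m, by rw [← hm]; push_cast; rfl⟩
  obtain ⟨q₂, hq₂⟩ := hg₂
  obtain ⟨q₃, hq₃⟩ := hg₃
  obtain ⟨F₁, G₁, D₁, D₂, hG₁0, hD₁, hD₂, hF₁, hD₁int, hD₂int⟩ :=
    h.exists_rat_presentation hf hk hrat ⟨q₂, hq₂⟩ ⟨q₃, hq₃⟩
  -- names for the expansions
  set a := qExpansion 1 (⇑F) with ha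
  set b := qExpansion 1 (⇑G) with hb
  set e := qExpansion 1 (⇑f) with he
  set a₁ := qExpansion 1 (⇑F₁) with ha₁
  set b₁ := qExpansion 1 (⇑G₁) with hb₁
  have hF0 : (F : ModularForm (Gamma0 N) k) ≠ 0 := h.numerator_ne_zero hf
  have hf' : (f : ModularForm (Gamma0 N) 2) ≠ 0 := by
    intro h0; apply hf; apply DFunLike.ext; intro τ; exact DFunLike.congr_fun h0 τ
  have hG₁0' : (G₁ : ModularForm (Gamma0 N) k) ≠ 0 := by
    intro h0; apply hG₁0; apply DFunLike.ext; intro τ; exact DFunLike.congr_fun h0 τ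
  have ha0 : a ≠ 0 := qExpansion_ne_zero_of_ne_zero hF0
  have hb0 : b ≠ 0 := qExpansion_ne_zero_of_ne_zero h.modularForm_ne_zero
  have he0 : e ≠ 0 := qExpansion_ne_zero_of_ne_zero hf'
  have hb₁0 : b₁ ≠ 0 := qExpansion_ne_zero_of_ne_zero hG₁0'
  have inj : Function.Injective (fun p : ℂ⟦X⟧ ↦ (p : LaurentSeries ℂ)) :=
    HahnSeries.ofPowerSeries_injective
  have hbL : (b : LaurentSeries ℂ) ≠ 0 := fun h0 ↦ hb0 (inj (h0.trans (map_zero _).symm))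
  have heL : (e : LaurentSeries ℂ) ≠ 0 := fun h0 ↦ he0 (inj (h0.trans (map_zero _).symm))
  -- Step 1: `a₁ b = b₁ a` and `z·W = −2abe` in `ℂ⟦q⟧`, `W = bθa − aθb`
  have hR : a₁ * b = b₁ * a := by
    apply inj
    change ((a₁ * b : ℂ⟦X⟧) : LaurentSeries ℂ) = ((b₁ * a : ℂ⟦X⟧) : LaurentSeries ℂ)
    rw [PowerSeries.coe_mul, PowerSeries.coe_mul, ← hF₁, ← h.coe_xFn_mul]
    ring
  set W := b * thetaPS a - a * thetaPS b with hW
  have hzW : z * W = -2 * a * b * e := by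
    have hxa : ((h.xFn : modularFunctionField N) : LaurentSeries ℂ) =
        (a : LaurentSeries ℂ) / (b : LaurentSeries ℂ) := rfl
    have hy := h.coe_yFn hf
    rw [hy, hxa, ← ha, ← hb, ← he, PowerSeries.coe_mul, PowerSeries.coe_mul, mul_div_assoc',
      div_eq_iff (mul_ne_zero (mul_ne_zero hbL hbL) heL)] at hz
    have hz' : ((z * W * b : ℂ⟦X⟧) : LaurentSeries ℂ) = ((-2 * a * b * e * b : ℂ⟦X⟧) : LaurentSeries ℂ) := by
      simp only [PowerSeries.coe_mul, PowerSeries.coe_neg, map_ofNat, hW]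
      rw [hz]
      field_simp
    exact mul_right_cancel₀ hb0 (inj hz')
  -- Step 2: transfer to the rational presentation: `z·W₁ = −2a₁b₁e`, `W₁ = b₁θa₁ − a₁θb₁`
  set W₁ := b₁ * thetaPS a₁ - a₁ * thetaPS b₁ with hW₁
  have hWr : W₁ * b ^ 2 = W * b₁ ^ 2 := wronskian_mul_sq_eq hb0 hR
  have hzW₁ : z * W₁ = -2 * a₁ * b₁ * e := by
    have key : (z * W₁) * b ^ 2 = (-2 * a₁ * b₁ * e) * b ^ 2 := by
      linear_combination z * hWr + b₁ ^ 2 * hzW + 2 * b * b₁ * e * hR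
    exact mul_right_cancel₀ (pow_ne_zero 2 hb0) key
  have htwo : (2 : ℂ⟦X⟧) ≠ 0 := by
    intro h2
    have := congrArg constantCoeff h2
    rw [map_ofNat, map_zero] at this
    norm_num at this
  have hW0 : W ≠ 0 := by
    intro h0
    rw [h0, mul_zero] at hzW
    exact mul_ne_zero (mul_ne_zero (mul_ne_zero (neg_ne_zero.mpr htwo) ha0) hb0) he0 hzW.symm
  have hW₁0 : W₁ ≠ 0 := by
    intro h0
    rw [h0, zero_mul] at hWr
    exact mul_ne_zero hW0 (pow_ne_zero 2 hb₁0) hWr.symm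
  -- Step 3: integral models of `D₂a₁`, `D₁b₁`, `e`
  obtain ⟨A, hA⟩ := exists_int_series_of_int_mul_cuspCoeff hD₂int
  obtain ⟨B, hB⟩ := exists_int_series_of_int_mul_cuspCoeff hD₁int
  choose m hm using hint
  set E : ℤ⟦X⟧ := PowerSeries.mk m with hE
  have hEmap : E.map (Int.castRingHom ℂ) = e := by
    ext n; rw [coeff_map, hE, coeff_mk, eq_intCast, hm n]; rfl
  set Q : ℤ⟦X⟧ := B * (PowerSeries.mk fun n ↦ (n : ℤ) * coeff n A) -
    A * (PowerSeries.mk fun n ↦ (n : ℤ) * coeff n B) with hQ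
  set P : ℤ⟦X⟧ := -2 * A * B * E with hP
  have hθC : ∀ (c : ℂ) (T : ℂ⟦X⟧), thetaPS (C c * T) = C c * thetaPS T := fun c T ↦ by
    ext n; simp [coeff_thetaPS, mul_left_comm]
  have hQmap : Q.map (Int.castRingHom ℂ) = C ((D₁ : ℂ) * D₂) * W₁ := by
    rw [hQ, map_sub, map_mul, map_mul, map_mk_mul_coeff_eq_thetaPS, map_mk_mul_coeff_eq_thetaPS, hA, hB,
      hθC, hθC, hW₁, ← ha₁, ← hb₁, map_mul]
    ring
  have hPmap : P.map (Int.castRingHom ℂ) = C ((D₁ : ℂ) * D₂) * (-2 * a₁ * b₁ * e) := by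
    rw [hP, map_mul, map_mul, map_mul, hA, hB, hEmap, ← ha₁, ← hb₁, map_neg, map_ofNat, map_mul]
    ring
  have hzQ : z * Q.map (Int.castRingHom ℂ) = P.map (Int.castRingHom ℂ) := by
    rw [hQmap, hPmap, mul_left_comm, hzW₁]
  have hQ0 : Q ≠ 0 := by
    intro h0
    have : C ((D₁ : ℂ) * D₂) * W₁ = 0 := by rw [← hQmap, h0, map_zero]
    rcases mul_eq_zero.mp this with h1 | h1
    · have hD : ((D₁ : ℂ) * D₂) ≠ 0 := mul_ne_zero (by exact_mod_cast hD₁.ne') (by exact_mod_cast hD₂.ne')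
      exact hD (by simpa using congrArg constantCoeff h1)
    · exact hW₁0 h1
  -- Step 4: `z` has rational coefficients (it is fixed by `Aut(ℂ)`, as `x` and `y` are)
  have hxne : ((h.xFn : modularFunctionField N) : LaurentSeries ℂ) ≠ 0 := by
    have hx0 : h.xFn ≠ 0 := by rw [h.xFn_def]; exact mkFn_ne_zero h.modularForm_ne_zero hF0
    exact fun h0 ↦ hx0 (Subtype.ext h0)
  have h2L : (2 : LaurentSeries ℂ) ≠ 0 := fun h0 ↦
    htwo (inj (((map_ofNat _ 2).trans h0).trans (map_zero _).symm))
  have hyne : ((h.yFn hf : modularFunctionField N) : LaurentSeries ℂ) ≠ 0 := by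
    intro h0
    rw [h0, mul_zero] at hz
    exact mul_ne_zero (neg_ne_zero.mpr h2L) hxne hz.symm
  have hzeq : (z : LaurentSeries ℂ) = -2 * ((h.xFn : modularFunctionField N) : LaurentSeries ℂ) /
      ((h.yFn hf : modularFunctionField N) : LaurentSeries ℂ) := by
    rw [eq_div_iff hyne, hz]
  have hzσ : ∀ σ : ℂ ≃+* ℂ, z.map (σ : ℂ →+* ℂ) = z := by
    intro σ
    apply inj
    change (((z.map (σ : ℂ →+* ℂ) : ℂ⟦X⟧) : LaurentSeries ℂ)) = (z : LaurentSeries ℂ)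
    rw [← mapLaurent_coe_powerSeries, hzeq, map_div₀, map_mul, map_neg, map_ofNat,
      h.mapLaurent_xFn hf hrat σ (by rw [← hq₂, map_ratCast]) (by rw [← hq₃, map_ratCast]),
      h.mapLaurent_yFn hf hrat σ (by rw [← hq₂, map_ratCast]) (by rw [← hq₃, map_ratCast])]
  have hzrat : ∀ n, ∃ q : ℚ, (q : ℂ) = coeff n z := fun n ↦
    exists_ratCast_eq_of_forall_ringEquiv fun σ ↦ by
      have := congrArg (coeff n) (hzσ σ)
      rwa [coeff_map] at this
  choose zc hzc using hzrat
  set zq : ℚ⟦X⟧ := PowerSeries.mk zc with hzq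
  have hzqmap : zq.map (algebraMap ℚ ℂ) = z := by
    ext n; rw [coeff_map, hzq, coeff_mk, ← hzc n]; rfl
  refine ⟨zq, P, Q, hzqmap, hQ0, ?_⟩
  -- Step 5: descend the identity `z·Q = P` to `ℚ⟦q⟧`
  have hinj : Function.Injective (PowerSeries.map (algebraMap ℚ ℂ)) := by
    intro u v huv
    ext n
    have := congrArg (coeff n) huv
    rw [coeff_map, coeff_map] at this
    exact (algebraMap ℚ ℂ).injective this
  apply hinj
  have hmm : ∀ φ : ℤ⟦X⟧, (φ.map (Int.castRingHom ℚ)).map (algebraMap ℚ ℂ) = φ.map (Int.castRingHom ℂ) := by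
    intro φ; ext n; simp [coeff_map]
  rw [map_mul, hzqmap, hmm, hmm]
  exact hzQ

end IsXPresentation


end Literature.NumberTheory.EllipticCurves.ModularForms
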